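import Summits.AnomalousDissipation.AnomalousDissipation.Theorems.SawtoothPulseCascadeK1LocalisedCascadeStripAverage
import Literature.Analysis.FunctionSpaces.TorusHolderSobolevEmbedding

/-!
# K1loc, line `Spectral` — S-D (thin start): SLAB AND ANTI-SLAB ENERGIES VIA WINDOW AVERAGES ALONG A LATTICE DIRECTION

Helper file of the prover lane on the crux `K1LocalisedCascade` (stmt-AnomalousDissipation-19491), route
`SawtoothPulseCascade` (glue seat k1loc-p3; S-B ↔ S-D hand-over).  Directional twin of `…StripAverage`: for an integer direction
`v ∈ ℤ^d` the window average `W_h^v θ(x) = ∫_{−h}^{h} θ(x + u·v) du` along the closed line `u ↦ x + u·v` has the torus multiplier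
`2h·sinc(2πh·(k·v))` (`mFourierCoeff_dirWindowAvg`; `k·v ∈ ℤ`).  Hence
* **slab**: `Σ' k, [|k·v| ≤ L]·‖𝓕θ(k)‖² ≤ (πL)²·‖W^v_{1/(4L)}θ‖₂²` (`tsum_slab_le_dirWindowAvg`, Jordan);
* **anti-slab**: `Σ' k, [M ≤ |k·v|]·‖𝓕θ(k)‖² ≤ (π/(π−1))²·‖θ − M·W^v_{1/(2M)}θ‖₂²` (`tsum_antislab_le_sub_dirWindowAvg`; `sinc x ≤ 1/|x| ≤ 1/π`
  for `|x| ≥ π`): the energy far from the hyperplane `k·v = 0` is controlled by the deviation of `θ` from its local average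
  ALONG `v`.
Use (off-cone channel of the thin-start target, `…ThinChannels`): at a phase start the flat cells of the inviscid iterate are plane
waves with `k_c ∥ (γ, ∓1)`, i.e. constant along the unstable lattice directions `v± = (1, ±γ)` (`γ ∈ ℤ`), while steep modes
(`13/10·|k₀| ≤ γ|k₁|`) outside the strip have `|k·v±| ≥ (3/10)L`; so the off-cone energy of each sign branch is an anti-slab energy,
bounded by the `L²` deviation from the directional average — a cell-END count along the crest direction.
WHAT THIS IS NOT: no statement about the cascade. [cite: Grafakos2014, Prop. 3.2.2 (6) and Prop. 3.2.7 (3)] [problem: turb]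
-/

-- `Summit.<Summit>.<Problem>`: single-conjunct summit, the duplicate namespace segment is deliberate.
set_option linter.dupNamespace false

noncomputable section

namespace Summit.AnomalousDissipation.AnomalousDissipation.Theorems.SawtoothPulseCascade.K1Start

open MeasureTheory Set Filter Topology UnitAddTorus Function
open Literature.Analysis.FunctionSpaces Literature.Analysis.FunctionSpaces.Torus

variable {d : Type*} [Fintype d]

/-! ## §1 The line shift `u ↦ u·v` and the characters -/

omit [Fintype d] in
/-- The line shift `u ↦ (u·v_j)_j : ℝ → T^d` is continuous. [folklore] -/
theorem continuous_lineShift (v : d → ℤ) :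
    Continuous fun u : ℝ => (fun j => (((u * (v j : ℝ) : ℝ)) : UnitAddCircle) : UnitAddTorus d) :=
  continuous_pi fun _ => (AddCircle.continuous_mk' (1 : ℝ)).comp (continuous_id.mul continuous_const)

/-- **Characters on the line**: `e_k((u·v_j)_j) = e_{k·v}(u)`. [cite: Grafakos2014, Prop. 3.2.2 (6)] -/
theorem mFourier_lineShift (k v : d → ℤ) (u : ℝ) :
    mFourier k (fun j => (((u * (v j : ℝ) : ℝ)) : UnitAddCircle)) = (fourier (∑ j, k j * v j) ((u : ℝ) : UnitAddCircle) : ℂ) := by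
  simp only [mFourier, ContinuousMap.coe_mk, fourier_coe_apply]
  rw [← Complex.exp_sum]
  congr 1
  have e : ∀ j ∈ (Finset.univ : Finset d), (2 * Real.pi * Complex.I * ((k j : ℤ) : ℂ) * (((u * (v j : ℝ) : ℝ)) : ℂ) / (1 : ℝ) : ℂ) =
      (2 * Real.pi * Complex.I * u) * (((k j : ℤ) : ℂ) * ((v j : ℤ) : ℂ)) := by
    intro j _; push_cast; ring
  rw [Finset.sum_congr rfl e, ← Finset.mul_sum]
  push_cast
  ring

/-! ## §2 The directional window average and its multiplier -/

omit [Fintype d] in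
/-- The directional window average of a continuous field is continuous. [folklore] -/
theorem continuous_dirWindowAvg {θ : UnitAddTorus d → ℂ} (hθ : Continuous θ) (v : d → ℤ) (a b : ℝ) :
    Continuous fun x : UnitAddTorus d => ∫ u in a..b, θ (x + fun j => (((u * (v j : ℝ) : ℝ)) : UnitAddCircle)) := by
  have hF : Continuous (uncurry fun (x : UnitAddTorus d) (u : ℝ) =>
      θ (x + fun j => (((u * (v j : ℝ) : ℝ)) : UnitAddCircle))) :=
    hθ.comp (continuous_fst.add ((continuous_lineShift v).comp continuous_snd))
  exact intervalIntegral.continuous_parametric_intervalIntegral_of_continuous' hF a b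

/-- **The multiplier of the directional window**: `𝓕(x ↦ ∫_{−h}^{h} θ(x + u·v)du)(k) = 2h·sinc(2πh(k·v))·𝓕θ(k)`
(`θ` continuous, `h > 0`). [cite: Grafakos2014, Prop. 3.2.2 (6)] -/
theorem mFourierCoeff_dirWindowAvg {θ : UnitAddTorus d → ℂ} (hθ : Continuous θ) (v : d → ℤ) {h : ℝ} (hh : 0 < h)
    (k : d → ℤ) :
    mFourierCoeff (fun x : UnitAddTorus d => ∫ u in (-h)..h, θ (x + fun j => (((u * (v j : ℝ) : ℝ)) : UnitAddCircle))) k =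
      ((2 * h * Real.sinc (2 * Real.pi * ((∑ j, k j * v j : ℤ) : ℝ) * h) : ℝ) : ℂ) • mFourierCoeff θ k := by
  rw [mFourierCoeff_eq_integral_volume]
  set f : ℝ → UnitAddTorus d → ℂ :=
    fun u x => mFourier (-k) x • θ (x + fun j => (((u * (v j : ℝ) : ℝ)) : UnitAddCircle)) with hf
  have hcont : Continuous (uncurry f) := by
    refine Continuous.smul ((mFourier (-k)).continuous.comp continuous_snd) (hθ.comp ?_)
    exact continuous_snd.add ((continuous_lineShift v).comp continuous_fst)
  obtain ⟨C, hC⟩ := (isCompact_univ (X := UnitAddTorus d)).exists_bound_of_continuousOn hθ.continuousOn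
  have hbound : ∀ p : ℝ × UnitAddTorus d, ‖uncurry f p‖ ≤ C := by
    rintro ⟨u, x⟩
    simp only [uncurry, hf, norm_smul]
    calc ‖mFourier (-k) x‖ * ‖θ (x + fun j => (((u * (v j : ℝ) : ℝ)) : UnitAddCircle))‖ ≤ 1 * C :=
          mul_le_mul (((mFourier (-k)).norm_coe_le_norm x).trans_eq mFourier_norm) (hC _ (mem_univ _))
            (norm_nonneg _) zero_le_one
      _ = C := one_mul C
  have hint : Integrable (uncurry f) ((volume.restrict (Set.uIoc (-h) h)).prod (volume : Measure (UnitAddTorus d))) := by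
    rw [Set.uIoc_of_le (by linarith : -h ≤ h)]
    exact (integrable_const C).mono' hcont.aestronglyMeasurable (ae_of_all _ hbound)
  have h1 : (fun x : UnitAddTorus d => mFourier (-k) x •
      ∫ u in (-h)..h, θ (x + fun j => (((u * (v j : ℝ) : ℝ)) : UnitAddCircle))) = fun x => ∫ u in (-h)..h, f u x := by
    funext x
    rw [hf]
    exact (intervalIntegral.integral_smul _ _).symm
  rw [h1, ← intervalIntegral_integral_swap hint]
  have h2 : ∀ u : ℝ, ∫ x, f u x = (fourier (∑ j, k j * v j) ((u : ℝ) : UnitAddCircle) : ℂ) • mFourierCoeff θ k := by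
    intro u
    rw [hf, ← mFourier_lineShift k v u, ← mFourierCoeff_comp_add_right θ _ k, mFourierCoeff_eq_integral_volume]
  simp_rw [h2]
  rw [intervalIntegral.integral_smul_const, intervalIntegral_fourier_coe _ hh]

/-! ## §3 Slab energies -/

/-- **Slab energy is controlled by the directional window average**: for continuous `θ`, `v ∈ ℤ^d` and `L > 0`,
`Σ' k, [|k·v| ≤ L]·‖𝓕θ(k)‖² ≤ (πL)²·∫ ‖∫_{−1/(4L)}^{1/(4L)} θ(x + u·v) du‖² dx`. [cite: Grafakos2014, Prop. 3.2.7 (3)] -/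
theorem tsum_slab_le_dirWindowAvg {θ : UnitAddTorus d → ℂ} (hθ : Continuous θ) (v : d → ℤ) {L : ℝ} (hL : 0 < L) :
    ∑' k : d → ℤ, (if |((∑ j, k j * v j : ℤ) : ℝ)| ≤ L then (1 : ℝ) else 0) * ‖mFourierCoeff θ k‖ ^ 2 ≤
      (Real.pi * L) ^ 2 * ∫ x : UnitAddTorus d,
        ‖∫ u in (-(1 / (4 * L)))..(1 / (4 * L)), θ (x + fun j => (((u * (v j : ℝ) : ℝ)) : UnitAddCircle))‖ ^ 2 := by
  have hh : 0 < 1 / (4 * L) := by positivity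
  set W : UnitAddTorus d → ℂ :=
    fun x => ∫ u in (-(1 / (4 * L)))..(1 / (4 * L)), θ (x + fun j => (((u * (v j : ℝ) : ℝ)) : UnitAddCircle)) with hWdef
  have hWc : Continuous W := continuous_dirWindowAvg hθ v _ _
  have hW := hasSum_sq_mFourierCoeff_of_continuous hWc
  set μ : (d → ℤ) → ℝ := fun k => 2 * (1 / (4 * L)) * Real.sinc (2 * Real.pi * ((∑ j, k j * v j : ℤ) : ℝ) * (1 / (4 * L)))
    with hμdef
  have hWk : ∀ k : d → ℤ, ‖mFourierCoeff W k‖ ^ 2 = μ k ^ 2 * ‖mFourierCoeff θ k‖ ^ 2 := by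
    intro k
    have hk := mFourierCoeff_dirWindowAvg hθ v hh k
    rw [← hWdef] at hk
    rw [hk, norm_smul, mul_pow, Complex.norm_real, Real.norm_eq_abs, sq_abs]
  have hμ : ∀ k : d → ℤ, |((∑ j, k j * v j : ℤ) : ℝ)| ≤ L → 1 ≤ (Real.pi * L) ^ 2 * μ k ^ 2 := by
    intro k hk
    have hα : |2 * Real.pi * ((∑ j, k j * v j : ℤ) : ℝ) * (1 / (4 * L))| ≤ Real.pi / 2 := by
      have e : 2 * Real.pi * ((∑ j, k j * v j : ℤ) : ℝ) * (1 / (4 * L)) = Real.pi / (2 * L) * ((∑ j, k j * v j : ℤ) : ℝ) := by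
        field_simp; ring
      rw [e, abs_mul, abs_of_pos (by positivity : (0 : ℝ) < Real.pi / (2 * L))]
      calc Real.pi / (2 * L) * |((∑ j, k j * v j : ℤ) : ℝ)| ≤ Real.pi / (2 * L) * L :=
            mul_le_mul_of_nonneg_left hk (by positivity)
        _ = Real.pi / 2 := by field_simp
    have hs := two_div_pi_le_sinc hα
    have h1 : 1 ≤ Real.pi * L * μ k := by
      have e : Real.pi * L * μ k = (Real.pi / 2) * Real.sinc (2 * Real.pi * ((∑ j, k j * v j : ℤ) : ℝ) * (1 / (4 * L))) := by
        rw [hμdef]; field_simp; ring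
      rw [e]
      calc (1 : ℝ) = (Real.pi / 2) * (2 / Real.pi) := by field_simp
        _ ≤ (Real.pi / 2) * Real.sinc (2 * Real.pi * ((∑ j, k j * v j : ℤ) : ℝ) * (1 / (4 * L))) :=
            mul_le_mul_of_nonneg_left hs (by positivity)
    calc (1 : ℝ) ≤ (Real.pi * L * μ k) ^ 2 := by nlinarith
      _ = (Real.pi * L) ^ 2 * μ k ^ 2 := by ring
  have hle : ∀ k : d → ℤ, (if |((∑ j, k j * v j : ℤ) : ℝ)| ≤ L then (1 : ℝ) else 0) * ‖mFourierCoeff θ k‖ ^ 2 ≤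
      (Real.pi * L) ^ 2 * ‖mFourierCoeff W k‖ ^ 2 := by
    intro k
    rw [hWk k]
    split_ifs with hk
    · calc (1 : ℝ) * ‖mFourierCoeff θ k‖ ^ 2 ≤ ((Real.pi * L) ^ 2 * μ k ^ 2) * ‖mFourierCoeff θ k‖ ^ 2 :=
            mul_le_mul_of_nonneg_right (hμ k hk) (sq_nonneg _)
        _ = _ := by ring
    · rw [zero_mul]; positivity
  have hsum2 : Summable fun k : d → ℤ => (Real.pi * L) ^ 2 * ‖mFourierCoeff W k‖ ^ 2 := hW.summable.mul_left _
  have hnn : ∀ k : d → ℤ, 0 ≤ (if |((∑ j, k j * v j : ℤ) : ℝ)| ≤ L then (1 : ℝ) else 0) * ‖mFourierCoeff θ k‖ ^ 2 :=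
    fun k => mul_nonneg (by split_ifs <;> norm_num) (sq_nonneg _)
  have hsum1 := Summable.of_nonneg_of_le hnn hle hsum2
  calc ∑' k : d → ℤ, (if |((∑ j, k j * v j : ℤ) : ℝ)| ≤ L then (1 : ℝ) else 0) * ‖mFourierCoeff θ k‖ ^ 2
      ≤ ∑' k : d → ℤ, (Real.pi * L) ^ 2 * ‖mFourierCoeff W k‖ ^ 2 := Summable.tsum_le_tsum hle hsum1 hsum2
    _ = (Real.pi * L) ^ 2 * ∫ x : UnitAddTorus d, ‖W x‖ ^ 2 := by rw [tsum_mul_left, hW.tsum_eq]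

/-! ## §4 Anti-slab energies -/

/-- **Energy far from the hyperplane `k·v = 0` is controlled by the deviation from the directional average**: for continuous
`θ`, `v ∈ ℤ^d` and `M > 0`, with `h = 1/(2M)`,
`Σ' k, [M ≤ |k·v|]·‖𝓕θ(k)‖² ≤ (π/(π−1))²·∫ ‖θ(x) − M·∫_{−h}^{h} θ(x + u·v) du‖² dx`
(multiplier `1 − sinc(2πh(k·v)) ≥ 1 − 1/π` there). [cite: Grafakos2014, Prop. 3.2.7 (3)] -/
theorem tsum_antislab_le_sub_dirWindowAvg {θ : UnitAddTorus d → ℂ} (hθ : Continuous θ) (v : d → ℤ) {M : ℝ} (hM : 0 < M) :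
    ∑' k : d → ℤ, (if M ≤ |((∑ j, k j * v j : ℤ) : ℝ)| then (1 : ℝ) else 0) * ‖mFourierCoeff θ k‖ ^ 2 ≤
      (Real.pi / (Real.pi - 1)) ^ 2 * ∫ x : UnitAddTorus d,
        ‖θ x - (M : ℂ) * ∫ u in (-(1 / (2 * M)))..(1 / (2 * M)), θ (x + fun j => (((u * (v j : ℝ) : ℝ)) : UnitAddCircle))‖ ^ 2 := by
  have hh : 0 < 1 / (2 * M) := by positivity
  have hπ1 : 0 < Real.pi - 1 := by linarith [Real.two_le_pi]
  set W : UnitAddTorus d → ℂ :=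
    fun x => ∫ u in (-(1 / (2 * M)))..(1 / (2 * M)), θ (x + fun j => (((u * (v j : ℝ) : ℝ)) : UnitAddCircle)) with hWdef
  set D : UnitAddTorus d → ℂ := fun x => θ x - (M : ℂ) * W x with hDdef
  have hWc : Continuous W := continuous_dirWindowAvg hθ v _ _
  have hDc : Continuous D := hθ.sub (continuous_const.mul hWc)
  have hD := hasSum_sq_mFourierCoeff_of_continuous hDc
  -- the multiplier of `D` is `1 - sinc`
  have hDk : ∀ k : d → ℤ, mFourierCoeff D k =
      ((1 - Real.sinc (2 * Real.pi * ((∑ j, k j * v j : ℤ) : ℝ) * (1 / (2 * M))) : ℝ) : ℂ) • mFourierCoeff θ k := by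
    intro k
    have hi1 : Integrable (fun x : UnitAddTorus d => mFourier (-k) x • θ x) volume :=
      ((mFourier (-k)).continuous.smul hθ).integrable_unitAddTorus
    have hi2 : Integrable (fun x : UnitAddTorus d => mFourier (-k) x • ((M : ℂ) * W x)) volume :=
      ((mFourier (-k)).continuous.smul (continuous_const.mul hWc)).integrable_unitAddTorus
    have e1 : mFourierCoeff D k = mFourierCoeff θ k - mFourierCoeff (fun x => (M : ℂ) * W x) k := by
      rw [hDdef]
      simp only [mFourierCoeff_eq_integral_volume, smul_sub]
      exact integral_sub hi1 hi2
    have e2 : mFourierCoeff (fun x => (M : ℂ) * W x) k = (M : ℂ) * mFourierCoeff W k := by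
      simp only [mFourierCoeff_eq_integral_volume, smul_eq_mul]
      rw [← integral_const_mul]
      refine integral_congr_ae (Eventually.of_forall fun x => ?_)
      ring
    have e3 := mFourierCoeff_dirWindowAvg hθ v hh k
    rw [← hWdef] at e3
    rw [e1, e2, e3, smul_eq_mul, smul_eq_mul]
    generalize Real.sinc (2 * Real.pi * ((∑ j, k j * v j : ℤ) : ℝ) * (1 / (2 * M))) = σ
    have hM0 : (M : ℂ) ≠ 0 := by exact_mod_cast hM.ne'
    push_cast
    field_simp
  -- on the anti-slab the multiplier is at least `1 - 1/π`
  have hs : ∀ k : d → ℤ, M ≤ |((∑ j, k j * v j : ℤ) : ℝ)| →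
      1 - Real.pi⁻¹ ≤ 1 - Real.sinc (2 * Real.pi * ((∑ j, k j * v j : ℤ) : ℝ) * (1 / (2 * M))) := by
    intro k hk
    have hx : Real.pi ≤ |2 * Real.pi * ((∑ j, k j * v j : ℤ) : ℝ) * (1 / (2 * M))| := by
      have e : 2 * Real.pi * ((∑ j, k j * v j : ℤ) : ℝ) * (1 / (2 * M)) = Real.pi / M * ((∑ j, k j * v j : ℤ) : ℝ) := by
        field_simp
      rw [e, abs_mul, abs_of_pos (by positivity : (0 : ℝ) < Real.pi / M)]
      calc Real.pi = Real.pi / M * M := by field_simp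
        _ ≤ Real.pi / M * |((∑ j, k j * v j : ℤ) : ℝ)| := mul_le_mul_of_nonneg_left hk (by positivity)
    have hx0 : 2 * Real.pi * ((∑ j, k j * v j : ℤ) : ℝ) * (1 / (2 * M)) ≠ 0 :=
      abs_pos.mp (lt_of_lt_of_le Real.pi_pos hx)
    have h1 := Real.sinc_le_inv_abs hx0
    have h2 : |2 * Real.pi * ((∑ j, k j * v j : ℤ) : ℝ) * (1 / (2 * M))|⁻¹ ≤ Real.pi⁻¹ := inv_anti₀ Real.pi_pos hx
    linarith
  have hle : ∀ k : d → ℤ, (if M ≤ |((∑ j, k j * v j : ℤ) : ℝ)| then (1 : ℝ) else 0) * ‖mFourierCoeff θ k‖ ^ 2 ≤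
      (Real.pi / (Real.pi - 1)) ^ 2 * ‖mFourierCoeff D k‖ ^ 2 := by
    intro k
    rw [hDk k, norm_smul, mul_pow, Complex.norm_real, Real.norm_eq_abs, sq_abs]
    generalize hσ : Real.sinc (2 * Real.pi * ((∑ j, k j * v j : ℤ) : ℝ) * (1 / (2 * M))) = σ
    split_ifs with hk
    · have h1 : 1 - Real.pi⁻¹ ≤ 1 - σ := hσ ▸ hs k hk
      have h3 : 1 ≤ (Real.pi / (Real.pi - 1)) * (1 - σ) := by
        have e : (Real.pi / (Real.pi - 1)) * (1 - Real.pi⁻¹) = 1 := by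
          field_simp
        calc (1 : ℝ) = (Real.pi / (Real.pi - 1)) * (1 - Real.pi⁻¹) := e.symm
          _ ≤ (Real.pi / (Real.pi - 1)) * (1 - σ) := mul_le_mul_of_nonneg_left h1 (by positivity)
      have h4 : (1 : ℝ) ≤ ((Real.pi / (Real.pi - 1)) * (1 - σ)) ^ 2 := by nlinarith
      calc (1 : ℝ) * ‖mFourierCoeff θ k‖ ^ 2 ≤ ((Real.pi / (Real.pi - 1)) * (1 - σ)) ^ 2 * ‖mFourierCoeff θ k‖ ^ 2 :=
            mul_le_mul_of_nonneg_right h4 (sq_nonneg _)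
        _ = _ := by ring
    · rw [zero_mul]; positivity
  have hsum2 : Summable fun k : d → ℤ => (Real.pi / (Real.pi - 1)) ^ 2 * ‖mFourierCoeff D k‖ ^ 2 := hD.summable.mul_left _
  have hnn : ∀ k : d → ℤ, 0 ≤ (if M ≤ |((∑ j, k j * v j : ℤ) : ℝ)| then (1 : ℝ) else 0) * ‖mFourierCoeff θ k‖ ^ 2 :=
    fun k => mul_nonneg (by split_ifs <;> norm_num) (sq_nonneg _)
  have hsum1 := Summable.of_nonneg_of_le hnn hle hsum2
  calc ∑' k : d → ℤ, (if M ≤ |((∑ j, k j * v j : ℤ) : ℝ)| then (1 : ℝ) else 0) * ‖mFourierCoeff θ k‖ ^ 2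
      ≤ ∑' k : d → ℤ, (Real.pi / (Real.pi - 1)) ^ 2 * ‖mFourierCoeff D k‖ ^ 2 := Summable.tsum_le_tsum hle hsum1 hsum2
    _ = (Real.pi / (Real.pi - 1)) ^ 2 * ∫ x : UnitAddTorus d, ‖D x‖ ^ 2 := by rw [tsum_mul_left, hD.tsum_eq]

end Summit.AnomalousDissipation.AnomalousDissipation.Theorems.SawtoothPulseCascade.K1Start
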